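import Literature.NumberTheory.LFunctions.ZetaZeroFreeRegion
import Literature.NumberTheory.LFunctions.PretentiousZeta
import Literature.NumberTheory.LFunctions.MontgomeryVaughan2001PrimeSums
import Literature.NumberTheory.LFunctions.CharacterVonMangoldtSums
import Mathlib.NumberTheory.LSeries.Deriv
import Mathlib.NumberTheory.LSeries.Dirichlet
import Mathlib.NumberTheory.LSeries.Nonvanishing
import Mathlib.Analysis.Calculus.MeanValue
import HarnessLib

/-!
# Montgomery 1983, §3 — the prime Dirichlet series `P(w) = Σ_p p^{-w}` on `Re w > 1` (the estimates (17) used)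

Companion of `Literature/Barriers/RiemannHypothesis/TuranPartialSums.lean` (named fact
`Literature.Barriers.RiemannHypothesis.Montgomery1983_theorem`, Montgomery 1983, Theorem p. 497) and of
`TuranPartialSumsMontgomeryTwist.lean`. Everything here is PROVED; the definitions are auxiliary
concrete objects (the prime indicator, `P`, `Λ₂`, `Σ_p p^{-2}`).

In §3 the source writes `log f*(s) = Σ_n (Λ(n)/log n) a*(n) n^{-s} = Σ_k b̂(k) log ζ(s − ik)` and uses
the classical bounds (17) "`ζ'/ζ(s) ≪ log t`, `log ζ(s) ≪ log log t` whenever `σ ≥ 1 − c₁(log t)^{-1}`,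
`t ≥ 2`" to control `g_k` (Lemma 4, (18)–(19)). The formalisation never leaves the half-plane `σ > 1`
(see the module docstring of `TuranPartialSumsMontgomeryHankel.lean`), so instead of `log ζ` it works
with the prime sum `P(w) = Σ_p p^{-w}` itself (`Σ_p a(p)p^{-s} = Σ_k b̂(k) P(s − ik)` exactly, by the
pointwise expansion `a(p) = Σ_k b̂(k)p^{ik}`), and needs (17) only ON AND TO THE RIGHT of `σ = 1`:

* `montgomeryP w = LSeries primeIndicator w = Σ_p p^{-w}` (`montgomeryP_eq_tsum_primes`; it is the tree's
  `primeSum 1`, `montgomeryP_eq_primeSum`), holomorphic on `Re w > 1` with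
  `P'(w) = −Σ_p (log p) p^{-w}` (Mathlib's `LSeries_hasDerivAt`); `‖P(w)‖ ≤ P(Re w)` and
  `P(x) ≤ log(x/(x−1)) + Σ_p p^{-2}` for real `x > 1` (`montgomeryP_re_le`, from the tree's
  `|Re P(s) − log|ζ(s)|| ≤ Σ_p p^{-2}` and `ζ(x) ≤ x/(x−1)`).
* `P'(w) = ζ'/ζ(w) + O(1)` on `Re w > 1` (`exists_norm_deriv_montgomeryP_sub_logDeriv_zeta_le`): the
  difference is `L(Λ₂, w)`, `Λ₂ = Λ·[not prime]`, bounded through the tree's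
  `Σ_{n ≤ x, n not prime} Λ(n)/n = O(1)` (`CharacterVonMangoldtSums.lean`).
* (17) on `1 ≤ σ ≤ 2`: `ζ'/ζ(σ+it) ≪ log(|t|+4)` for `|t| ≥ 1/2` (`exists_norm_logDeriv_zeta_le_log`, from the
  tree's de la Vallée Poussin bound `exists_norm_logDeriv_riemannZeta_le`, `ZetaZeroFreeRegion.lean`, and
  continuity on `1/2 ≤ |t| ≤ 2`), and `ζ'/ζ(s) + 1/(s−1) = ζ₁'/ζ₁(s) = O(1)` on `|Im s| ≤ 1`
  (`exists_norm_logDeriv_zeta_add_inv_le`, Mathlib's entire `riemannZeta₁`).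
* Hence `P'(w) ≪ log(|Im w|+4)` (`|Im w| ≥ 1/2`) and `P'(w) + 1/(w−1) = O(1)` (`|Im w| ≤ 1`) on
  `1 < Re w ≤ 2` (`exists_norm_deriv_montgomeryP_le_log`, `exists_norm_deriv_montgomeryP_add_inv_le`), and,
  integrating along horizontal segments, `P(w) + log(w−1) = O(1)` (`|Im w| ≤ 1`,
  `exists_norm_montgomeryP_add_log_le`) and `‖P(w)‖ ≤ log log(|Im w|+4) + O(1)` (`|Im w| ≥ 1/2`,
  `exists_norm_montgomeryP_le_loglog`) — the two halves of "`log ζ(s) ≪ log log t`" that Lemma 4 uses.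

## References

* [Montgomery1983] H. L. Montgomery, *Zeros of approximations to the zeta function*, Studies in Pure
  Mathematics (Turán memorial), Birkhäuser 1983, 497–506: §3, (14)–(17), Lemmas 2 and 4.
* E. C. Titchmarsh, *The Theory of the Riemann Zeta-Function*, 2nd ed., Thm. 3.11 and (3.11.8)
  (the bounds (17)). [folklore]
-/

noncomputable section

open Complex Set Filter Topology LSeries
open scoped ArithmeticFunction.vonMangoldt

namespace Literature.Barriers.RiemannHypothesis

/-! ## The prime Dirichlet series `P(w) = Σ_p p^{-w}` -/

/-- The indicator of the primes, as complex coefficients. [folklore] -/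
def primeIndicator (n : ℕ) : ℂ := if n.Prime then 1 else 0

/-- `P(w) = Σ_p p^{-w}`, the Dirichlet series over the primes (an `LSeries` with coefficients the
indicator of the primes), absolutely convergent for `Re w > 1`; in §3 of the source it enters through
`Σ_n (Λ(n)/log n) a*(n) n^{-s} = Σ_k b̂(k) Σ_p p^{-(s-ik)} + O(1)`. [cite: Montgomery1983, §3 (14)] -/
def montgomeryP (w : ℂ) : ℂ := LSeries primeIndicator w

/-- `|1_P(n)| ≤ 1`. [folklore] -/
theorem norm_primeIndicator_le (n : ℕ) : ‖primeIndicator n‖ ≤ 1 := by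
  unfold primeIndicator; split_ifs <;> simp

/-- The abscissa of absolute convergence of `P` is at most `1`. [folklore] -/
theorem abscissaOfAbsConv_primeIndicator_le : abscissaOfAbsConv primeIndicator ≤ 1 :=
  LSeries.abscissaOfAbsConv_le_of_le_const ⟨1, fun n _ ↦ norm_primeIndicator_le n⟩

/-- `abscissaOfAbsConv 1_P < Re w` for `Re w > 1`. [folklore] -/
theorem abscissaOfAbsConv_primeIndicator_lt {w : ℂ} (hw : 1 < w.re) :
    abscissaOfAbsConv primeIndicator < w.re :=
  abscissaOfAbsConv_primeIndicator_le.trans_lt (by exact_mod_cast hw)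

/-- `P(w)` converges absolutely for `Re w > 1`. [folklore] -/
theorem LSeriesSummable_primeIndicator {w : ℂ} (hw : 1 < w.re) : LSeriesSummable primeIndicator w :=
  LSeriesSummable_of_bounded_of_one_lt_re (m := 1) (fun n _ ↦ norm_primeIndicator_le n) hw

/-- The terms of `P`: `term 1_P w n = 1_P(n) n^{-w}`. [folklore] -/
theorem term_primeIndicator (w : ℂ) (n : ℕ) :
    term primeIndicator w n = {p : ℕ | p.Prime}.indicator (fun n ↦ (n : ℂ) ^ (-w)) n := by
  rcases eq_or_ne n 0 with rfl | hn
  · simp [Set.indicator_of_notMem, Nat.not_prime_zero]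
  rw [term_of_ne_zero hn, primeIndicator]
  by_cases hp : n.Prime
  · rw [if_pos hp, Set.indicator_of_mem (show n ∈ {p : ℕ | p.Prime} from hp), cpow_neg, one_div]
  · rw [if_neg hp, Set.indicator_of_notMem (show n ∉ {p : ℕ | p.Prime} from hp), zero_div]

/-- `P(w) = Σ_{p prime} p^{-w}` as a sum over the primes. [cite: Montgomery1983, §3] -/
theorem montgomeryP_eq_tsum_primes (w : ℂ) :
    montgomeryP w = ∑' p : Nat.Primes, ((p : ℕ) : ℂ) ^ (-w) := by
  rw [montgomeryP, LSeries]
  simp_rw [term_primeIndicator]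
  exact (tsum_subtype {p : ℕ | p.Prime} (fun n : ℕ ↦ (n : ℂ) ^ (-w))).symm

/-- `P` coincides with the tree's `primeSum 1` (`PretentiousZeta.lean`). [folklore] -/
theorem montgomeryP_eq_primeSum (w : ℂ) :
    montgomeryP w = Literature.NumberTheory.LFunctions.primeSum (fun _ ↦ 1) w := by
  rw [montgomeryP, LSeries, Literature.NumberTheory.LFunctions.primeSum]
  refine tsum_congr fun n ↦ ?_
  rw [term_primeIndicator]
  simp

/-- `P` is holomorphic on `Re w > 1` with `P'(w) = −Σ_p (log p) p^{-w}`. [folklore] -/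
theorem hasDerivAt_montgomeryP {w : ℂ} (hw : 1 < w.re) :
    HasDerivAt montgomeryP (-LSeries (logMul primeIndicator) w) w :=
  LSeries_hasDerivAt (abscissaOfAbsConv_primeIndicator_lt hw)

/-- `P'(w) = −L(log · 1_P, w)` for `Re w > 1`. [folklore] -/
theorem deriv_montgomeryP {w : ℂ} (hw : 1 < w.re) :
    deriv montgomeryP w = -LSeries (logMul primeIndicator) w :=
  (hasDerivAt_montgomeryP hw).deriv

/-- `P` is differentiable at every `w` with `Re w > 1`. [folklore] -/
theorem differentiableAt_montgomeryP {w : ℂ} (hw : 1 < w.re) : DifferentiableAt ℂ montgomeryP w :=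
  (hasDerivAt_montgomeryP hw).differentiableAt

/-- The terms over the primes: `‖p^{-w}‖ = p^{-Re w}`, a summable family for `Re w > 1`. [folklore] -/
theorem summable_primes_rpow_neg_re {w : ℂ} (hw : 1 < w.re) :
    Summable fun p : Nat.Primes ↦ ((p : ℕ) : ℝ) ^ (-w.re) :=
  Nat.Primes.summable_rpow.2 (by linarith)

/-- `P(x)` is real for real `x > 1`: `P(x) = Σ_p p^{-x}`. [folklore] -/
theorem montgomeryP_ofReal (x : ℝ) :
    montgomeryP (x : ℂ) = ((∑' p : Nat.Primes, ((p : ℕ) : ℝ) ^ (-x) : ℝ) : ℂ) := by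
  rw [montgomeryP_eq_tsum_primes, ofReal_tsum]
  refine tsum_congr fun p ↦ ?_
  rw [ofReal_cpow (Nat.cast_nonneg _), ofReal_natCast]
  push_cast
  ring_nf

/-- `‖P(w)‖ ≤ Σ_p p^{-Re w} = P(Re w)` for `Re w > 1`. [folklore] -/
theorem norm_montgomeryP_le_re {w : ℂ} (hw : 1 < w.re) :
    ‖montgomeryP w‖ ≤ (montgomeryP (w.re : ℂ)).re := by
  rw [montgomeryP_ofReal, ofReal_re, montgomeryP_eq_tsum_primes]
  have h1 : ∀ p : Nat.Primes, ‖((p : ℕ) : ℂ) ^ (-w)‖ = ((p : ℕ) : ℝ) ^ (-w.re) := fun p ↦ by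
    rw [norm_natCast_cpow_of_pos p.2.pos, neg_re]
  have hs : Summable fun p : Nat.Primes ↦ ‖((p : ℕ) : ℂ) ^ (-w)‖ := by
    simp_rw [h1]; exact summable_primes_rpow_neg_re hw
  refine (norm_tsum_le_tsum_norm hs).trans (le_of_eq (tsum_congr fun p ↦ h1 p))

/-- For real `1 < x ≤ 2`: `0 ≤ P(x) ≤ log(x/(x−1)) + Σ_p p^{-2}` (compare with `log ζ(x)`:
`|Re P(s) − log|ζ(s)|| ≤ Σ_p p^{-2}` and `ζ(x) ≤ x/(x−1)`). [folklore] -/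
theorem montgomeryP_re_le {x : ℝ} (hx : 1 < x) :
    (montgomeryP (x : ℂ)).re ≤ Real.log (x / (x - 1)) + ∑' p : Nat.Primes, ((p : ℕ) : ℝ) ^ (-2 : ℝ) := by
  have hx' : 1 < ((x : ℂ)).re := by simpa using hx
  have h := Literature.NumberTheory.LFunctions.abs_re_primeSum_one_sub_log_norm_zeta_le hx'
  rw [← montgomeryP_eq_primeSum] at h
  have hζ : Real.log ‖riemannZeta (x : ℂ)‖ ≤ Real.log (x / (x - 1)) := by
    have h1 := Literature.NumberTheory.LFunctions.MontgomeryVaughan2001.norm_zeta_real_le hx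
    have h0 : 0 < ‖riemannZeta (x : ℂ)‖ := by
      have := Literature.NumberTheory.LFunctions.MontgomeryVaughan2001.inv_sub_one_le_norm_zeta hx
      have : 0 < 1 / (x - 1) := by positivity
      linarith
    exact Real.log_le_log h0 h1
  have := (abs_le.1 h).2
  linarith

/-- `0 ≤ Re P(x)` for real `x > 1`. [folklore] -/
theorem montgomeryP_re_nonneg (x : ℝ) : 0 ≤ (montgomeryP (x : ℂ)).re := by
  rw [montgomeryP_ofReal, ofReal_re]
  exact tsum_nonneg fun p ↦ Real.rpow_nonneg (Nat.cast_nonneg _) _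

/-! ## `P'` against `ζ'/ζ`: the prime powers `p^k`, `k ≥ 2` -/

/-- The part of von Mangoldt's function supported on the proper prime powers:
`Λ₂(n) = Λ(n)` if `n` is not prime, `0` if `n` is prime. [folklore] -/
def vonMangoldt₂ (n : ℕ) : ℝ := if n.Prime then 0 else Λ n

/-- `Λ₂ ≥ 0`. [folklore] -/
theorem vonMangoldt₂_nonneg (n : ℕ) : 0 ≤ vonMangoldt₂ n := by
  unfold vonMangoldt₂; split_ifs
  · exact le_rfl
  · exact ArithmeticFunction.vonMangoldt_nonneg

/-- `Λ = log · 1_P + Λ₂` (as complex coefficients). [folklore] -/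
theorem vonMangoldt_eq_logMul_add (n : ℕ) :
    ((Λ n : ℝ) : ℂ) = logMul primeIndicator n + (vonMangoldt₂ n : ℂ) := by
  rw [logMul, primeIndicator, vonMangoldt₂]
  by_cases hp : n.Prime
  · rw [if_pos hp, if_pos hp, ArithmeticFunction.vonMangoldt_apply_prime hp, mul_one, ofReal_zero,
      add_zero, ofReal_log (Nat.cast_nonneg _), ofReal_natCast]
  · rw [if_neg hp, if_neg hp, mul_zero, zero_add]

/-- `Σ_{n < N} Λ₂(n)/n ≤ C₀` uniformly in `N` (the tree's `sum_not_prime_vonMangoldt_div_le`,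
from `ψ − θ ≪ √x log x`). [folklore] -/
theorem exists_sum_range_vonMangoldt₂_div_le :
    ∃ C₀ : ℝ, 0 ≤ C₀ ∧ ∀ N : ℕ, ∑ n ∈ Finset.range N, vonMangoldt₂ n / n ≤ C₀ := by
  obtain ⟨C₀, hC₀⟩ :=
    Literature.NumberTheory.LFunctions.CharacterMertens.sum_not_prime_vonMangoldt_div_le
  have hC₀0 : 0 ≤ C₀ := by simpa using hC₀ 0
  refine ⟨C₀, hC₀0, fun N ↦ ?_⟩
  rcases N with _ | N
  · simp [hC₀0]
  rw [Finset.range_eq_Ico, Finset.sum_eq_sum_Ico_succ_bot (Nat.succ_pos N)]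
  simp only [vonMangoldt₂, Nat.not_prime_zero, if_false, ArithmeticFunction.map_zero, Nat.cast_zero,
    div_zero, zero_add]
  have hI : Finset.Ico 1 (N + 1) = Finset.Icc 1 N := by
    ext n; simp only [Finset.mem_Ico, Finset.mem_Icc]; omega
  rw [hI]
  calc ∑ n ∈ Finset.Icc 1 N, (if n.Prime then (0 : ℝ) else Λ n) / n
      = ∑ n ∈ (Finset.Icc 1 N).filter (fun n ↦ ¬ n.Prime), Λ n / n := by
        rw [Finset.sum_filter]
        refine Finset.sum_congr rfl fun n _ ↦ ?_
        by_cases hp : n.Prime <;> simp [hp]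
    _ ≤ C₀ := hC₀ N

/-- `Σ_n Λ₂(n)/n` converges, with sum at most `C₀`. [folklore] -/
theorem summable_vonMangoldt₂_div : Summable fun n : ℕ ↦ vonMangoldt₂ n / n := by
  obtain ⟨C₀, _, h⟩ := exists_sum_range_vonMangoldt₂_div_le
  exact summable_of_sum_range_le (fun n ↦ div_nonneg (vonMangoldt₂_nonneg n) (Nat.cast_nonneg n)) h

/-- The terms of `L(Λ₂, w)` are dominated by `Λ₂(n)/n` for `Re w ≥ 1`. [folklore] -/
theorem norm_term_vonMangoldt₂_le {w : ℂ} (hw : 1 ≤ w.re) (n : ℕ) :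
    ‖term (fun n ↦ (vonMangoldt₂ n : ℂ)) w n‖ ≤ vonMangoldt₂ n / n := by
  rcases eq_or_ne n 0 with rfl | hn
  · simp
  rw [term_of_ne_zero hn, norm_div, norm_real, Real.norm_of_nonneg (vonMangoldt₂_nonneg n),
    norm_natCast_cpow_of_pos (Nat.pos_of_ne_zero hn)]
  refine div_le_div_of_nonneg_left (vonMangoldt₂_nonneg n) (by exact_mod_cast Nat.pos_of_ne_zero hn) ?_
  calc (n : ℝ) = (n : ℝ) ^ (1 : ℝ) := (Real.rpow_one _).symm
    _ ≤ (n : ℝ) ^ w.re := Real.rpow_le_rpow_of_exponent_le (by exact_mod_cast Nat.pos_of_ne_zero hn) hw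

/-- `L(Λ₂, w)` converges absolutely for `Re w ≥ 1`, with `‖L(Λ₂, w)‖ ≤ C₀`. [folklore] -/
theorem LSeriesSummable_vonMangoldt₂ {w : ℂ} (hw : 1 ≤ w.re) :
    LSeriesSummable (fun n ↦ (vonMangoldt₂ n : ℂ)) w :=
  Summable.of_norm_bounded summable_vonMangoldt₂_div (norm_term_vonMangoldt₂_le hw)

/-- **`P'(w) = ζ'/ζ(w) + O(1)` on `Re w > 1`**: `‖P'(w) − ζ'/ζ(w)‖ ≤ C₀`, the difference being
`L(Λ₂, w)` (prime powers `p^k`, `k ≥ 2`; cf. Lemma 2 of the source, `log f₃ ≪ Σ p^{-2σ}`).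
[cite: Montgomery1983, Lemma 2] -/
theorem exists_norm_deriv_montgomeryP_sub_logDeriv_zeta_le :
    ∃ C₀ : ℝ, 0 ≤ C₀ ∧ ∀ w : ℂ, 1 < w.re →
      ‖deriv montgomeryP w - deriv riemannZeta w / riemannZeta w‖ ≤ C₀ := by
  obtain ⟨C₀, hC₀, h⟩ := exists_sum_range_vonMangoldt₂_div_le
  refine ⟨C₀, hC₀, fun w hw ↦ ?_⟩
  have hΛ : LSeries (fun n ↦ ((Λ n : ℝ) : ℂ)) w = -deriv riemannZeta w / riemannZeta w :=
    ArithmeticFunction.LSeries_vonMangoldt_eq_deriv_riemannZeta_div hw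
  have hsum1 : LSeriesSummable (logMul primeIndicator) w :=
    LSeriesSummable_logMul_of_lt_re (abscissaOfAbsConv_primeIndicator_lt hw)
  have hsum2 : LSeriesSummable (fun n ↦ (vonMangoldt₂ n : ℂ)) w := LSeriesSummable_vonMangoldt₂ hw.le
  have hsplit : LSeries (fun n ↦ ((Λ n : ℝ) : ℂ)) w =
      LSeries (logMul primeIndicator) w + LSeries (fun n ↦ (vonMangoldt₂ n : ℂ)) w := by
    rw [← LSeries_add hsum1 hsum2]
    exact congrArg (fun f ↦ LSeries f w) (funext vonMangoldt_eq_logMul_add)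
  have hkey : deriv montgomeryP w - deriv riemannZeta w / riemannZeta w =
      LSeries (fun n ↦ (vonMangoldt₂ n : ℂ)) w := by
    rw [deriv_montgomeryP hw]
    have : deriv riemannZeta w / riemannZeta w = -LSeries (fun n ↦ ((Λ n : ℝ) : ℂ)) w := by
      rw [hΛ]; ring
    rw [this, hsplit]; ring
  rw [hkey]
  refine (norm_tsum_le_tsum_norm hsum2.norm).trans ?_
  refine (hsum2.norm.tsum_le_tsum (norm_term_vonMangoldt₂_le hw.le) summable_vonMangoldt₂_div).trans ?_
  exact Real.tsum_le_of_sum_range_le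
    (fun n ↦ div_nonneg (vonMangoldt₂_nonneg n) (Nat.cast_nonneg n)) h

/-! ## `ζ'/ζ` on `1 ≤ σ ≤ 2` (classical bounds on the line `σ = 1`) -/

/-- `ζ'/ζ` is continuous on compact sets of `{Re s ≥ 1}` avoiding `s = 1`: here, a bound on
`[1,2] × {1/2 ≤ |t| ≤ 2}`. [folklore] -/
theorem exists_bound_logDeriv_zeta_midrange :
    ∃ M : ℝ, 0 ≤ M ∧ ∀ σ t : ℝ, 1 ≤ σ → σ ≤ 2 → 1 / 2 ≤ |t| → |t| ≤ 2 →
      ‖deriv riemannZeta (σ + t * I) / riemannZeta (σ + t * I)‖ ≤ M := by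
  set K : Set ℂ := Icc (1 : ℝ) 2 ×ℂ (Icc (-2 : ℝ) (-1 / 2) ∪ Icc (1 / 2 : ℝ) 2) with hK
  have hKc : IsCompact K := isCompact_Icc.reProdIm (isCompact_Icc.union isCompact_Icc)
  have hne1 : ∀ s ∈ K, s ≠ 1 := by
    rintro s ⟨-, hs⟩ rfl
    simp only [mem_preimage, one_im, mem_union, mem_Icc] at hs
    rcases hs with ⟨_, h⟩ | ⟨h, _⟩ <;> linarith
  have hcont : ContinuousOn (fun s ↦ deriv riemannZeta s / riemannZeta s) K := by
    intro s hs
    have hs1 := hne1 s hs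
    have hζ : riemannZeta s ≠ 0 := riemannZeta_ne_zero_of_one_le_re hs.1.1
    have hopen : IsOpen ({1}ᶜ : Set ℂ) := isOpen_compl_singleton
    have han : AnalyticAt ℂ riemannZeta s :=
      (differentiableOn_riemannZeta_compl_one.analyticOnNhd hopen) s hs1
    exact (han.deriv.continuousAt.div han.continuousAt hζ).continuousWithinAt
  obtain ⟨M, hM⟩ := hKc.exists_bound_of_continuousOn hcont
  refine ⟨max M 0, le_max_right _ _, fun σ t h1 h2 h3 h4 ↦ (hM _ ?_).trans (le_max_left _ _)⟩
  refine ⟨by simpa using ⟨h1, h2⟩, ?_⟩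
  simp only [mem_preimage, add_im, ofReal_im, mul_im, ofReal_re, I_im, mul_one, I_re, mul_zero,
    add_zero, zero_add, mem_union, mem_Icc]
  rcases le_or_gt 0 t with ht | ht
  · rw [abs_of_nonneg ht] at h3 h4; exact Or.inr ⟨h3, h4⟩
  · rw [abs_of_neg ht] at h3 h4; exact Or.inl ⟨by linarith, by linarith⟩
where
  /-- `ζ` is differentiable away from `1` (Mathlib), as a `DifferentiableOn` statement. [folklore] -/
  differentiableOn_riemannZeta_compl_one : DifferentiableOn ℂ riemannZeta ({1}ᶜ : Set ℂ) :=
    fun _ hs ↦ (differentiableAt_riemannZeta hs).differentiableWithinAt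

/-- **`ζ'/ζ(σ+it) ≪ log(|t|+4)` for `1 ≤ σ ≤ 2`, `|t| ≥ 1/2`** (the classical bound (17) on the part of
the region used here, i.e. on and to the right of `σ = 1`: de la Vallée Poussin, from the tree's
`exists_norm_logDeriv_riemannZeta_le`, plus continuity for `|t| ≤ 2`).
[cite: Montgomery1983, §3 (17)] -/
theorem exists_norm_logDeriv_zeta_le_log :
    ∃ C : ℝ, 0 < C ∧ ∀ σ t : ℝ, 1 ≤ σ → σ ≤ 2 → 1 / 2 ≤ |t| →
      ‖deriv riemannZeta (σ + t * I) / riemannZeta (σ + t * I)‖ ≤ C * Real.log (|t| + 4) := by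
  obtain ⟨c, hc, C₁, hC₁, hZ⟩ := Literature.NumberTheory.LFunctions.exists_norm_logDeriv_riemannZeta_le
  obtain ⟨M, hM0, hM⟩ := exists_bound_logDeriv_zeta_midrange
  have hlog4 : 0 < Real.log 4 := Real.log_pos (by norm_num)
  refine ⟨max C₁ (M / Real.log 4) + 1, by positivity, fun σ t h1 h2 h3 ↦ ?_⟩
  have hlt : Real.log 4 ≤ Real.log (|t| + 4) := Real.log_le_log (by norm_num) (by linarith [abs_nonneg t])
  have hlpos : 0 < Real.log (|t| + 4) := hlog4.trans_le hlt
  rcases le_or_gt 2 |t| with ht | ht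
  · have hreg : 1 - c / Real.log |t| ≤ σ := by
      have : 0 ≤ c / Real.log |t| := div_nonneg hc.le (Real.log_nonneg (by linarith))
      linarith
    have := (hZ σ t ht hreg).2
    calc ‖deriv riemannZeta (σ + t * I) / riemannZeta (σ + t * I)‖ ≤ C₁ * Real.log |t| := this
      _ ≤ C₁ * Real.log (|t| + 4) := by
          refine mul_le_mul_of_nonneg_left (Real.log_le_log (by linarith) (by linarith)) hC₁
      _ ≤ (max C₁ (M / Real.log 4) + 1) * Real.log (|t| + 4) := by
          refine mul_le_mul_of_nonneg_right ?_ hlpos.le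
          linarith [le_max_left C₁ (M / Real.log 4)]
  · calc ‖deriv riemannZeta (σ + t * I) / riemannZeta (σ + t * I)‖ ≤ M := hM σ t h1 h2 h3 ht.le
      _ = (M / Real.log 4) * Real.log 4 := by field_simp
      _ ≤ (M / Real.log 4) * Real.log (|t| + 4) :=
          mul_le_mul_of_nonneg_left hlt (div_nonneg hM0 hlog4.le)
      _ ≤ (max C₁ (M / Real.log 4) + 1) * Real.log (|t| + 4) := by
          refine mul_le_mul_of_nonneg_right ?_ hlpos.le
          linarith [le_max_right C₁ (M / Real.log 4)]

/-- **`ζ'/ζ(s) + 1/(s−1)` is bounded near `s = 1`**: on `1 < Re s ≤ 2`, `|Im s| ≤ 1` it equals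
`ζ₁'/ζ₁(s)` for the entire, there non-vanishing `ζ₁(s) = (s−1)ζ(s)` (Mathlib's `riemannZeta₁`).
[folklore] -/
theorem exists_norm_logDeriv_zeta_add_inv_le :
    ∃ M : ℝ, 0 ≤ M ∧ ∀ s : ℂ, 1 < s.re → s.re ≤ 2 → |s.im| ≤ 1 →
      ‖deriv riemannZeta s / riemannZeta s + (s - 1)⁻¹‖ ≤ M := by
  set K : Set ℂ := Icc (1 : ℝ) 2 ×ℂ Icc (-1 : ℝ) 1 with hK
  have hKc : IsCompact K := isCompact_Icc.reProdIm isCompact_Icc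
  have hne : ∀ s ∈ K, riemannZeta₁ s ≠ 0 := by
    intro s hs
    by_cases h1 : s = 1
    · rw [h1, riemannZeta₁_one]; exact one_ne_zero
    · rw [Ne, Literature.NumberTheory.LFunctions.riemannZeta₁_eq_zero_iff h1]
      exact riemannZeta_ne_zero_of_one_le_re hs.1.1
  have hcont : ContinuousOn (fun s ↦ deriv riemannZeta₁ s / riemannZeta₁ s) K := by
    intro s hs
    have han : AnalyticAt ℂ riemannZeta₁ s := differentiable_riemannZeta₁.analyticAt s
    exact (han.deriv.continuousAt.div han.continuousAt (hne s hs)).continuousWithinAt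
  obtain ⟨M, hM⟩ := hKc.exists_bound_of_continuousOn hcont
  refine ⟨max M 0, le_max_right _ _, fun s h1 h2 h3 ↦ ?_⟩
  have hs1 : s ≠ 1 := by rintro rfl; simp at h1
  have hζ : riemannZeta s ≠ 0 := riemannZeta_ne_zero_of_one_le_re h1.le
  have hsK : s ∈ K := ⟨⟨h1.le, h2⟩, abs_le.1 h3⟩
  have key : deriv riemannZeta s / riemannZeta s + (s - 1)⁻¹ =
      deriv riemannZeta₁ s / riemannZeta₁ s := by
    have := Literature.NumberTheory.LFunctions.logDeriv_riemannZeta_eq hs1 hζ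
    rw [logDeriv_apply, logDeriv_apply] at this
    rw [this]; ring
  rw [key]
  exact (hM s hsK).trans (le_max_left _ _)

/-! ## Bounds for `P'` -/

/-- **`P'(w) ≪ log(|Im w| + 4)`** for `1 < Re w ≤ 2`, `|Im w| ≥ 1/2`.
[cite: Montgomery1983, §3 (17) and Lemma 4 (19)] -/
theorem exists_norm_deriv_montgomeryP_le_log :
    ∃ C : ℝ, 0 < C ∧ ∀ w : ℂ, 1 < w.re → w.re ≤ 2 → 1 / 2 ≤ |w.im| →
      ‖deriv montgomeryP w‖ ≤ C * Real.log (|w.im| + 4) := by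
  obtain ⟨C₀, hC₀, h₀⟩ := exists_norm_deriv_montgomeryP_sub_logDeriv_zeta_le
  obtain ⟨C, hC, hZ⟩ := exists_norm_logDeriv_zeta_le_log
  have hlog4 : 0 < Real.log 4 := Real.log_pos (by norm_num)
  refine ⟨C + C₀ / Real.log 4, by positivity, fun w h1 h2 h3 ↦ ?_⟩
  have hlt : Real.log 4 ≤ Real.log (|w.im| + 4) :=
    Real.log_le_log (by norm_num) (by linarith [abs_nonneg w.im])
  have hw : w = (w.re : ℂ) + w.im * I := (re_add_im w).symm
  have hZ' := hZ w.re w.im h1.le h2 h3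
  rw [← hw] at hZ'
  calc ‖deriv montgomeryP w‖
      ≤ ‖deriv montgomeryP w - deriv riemannZeta w / riemannZeta w‖ +
          ‖deriv riemannZeta w / riemannZeta w‖ := norm_le_norm_sub_add _ _
    _ ≤ C₀ + C * Real.log (|w.im| + 4) := add_le_add (h₀ w h1) hZ'
    _ = (C₀ / Real.log 4) * Real.log 4 + C * Real.log (|w.im| + 4) := by field_simp
    _ ≤ (C₀ / Real.log 4) * Real.log (|w.im| + 4) + C * Real.log (|w.im| + 4) := by
        gcongr
    _ = (C + C₀ / Real.log 4) * Real.log (|w.im| + 4) := by ring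

/-- **`P'(w) + 1/(w−1)` is bounded near `w = 1`** (`1 < Re w ≤ 2`, `|Im w| ≤ 1`).
[cite: Montgomery1983, Lemma 4] -/
theorem exists_norm_deriv_montgomeryP_add_inv_le :
    ∃ C : ℝ, 0 ≤ C ∧ ∀ w : ℂ, 1 < w.re → w.re ≤ 2 → |w.im| ≤ 1 →
      ‖deriv montgomeryP w + (w - 1)⁻¹‖ ≤ C := by
  obtain ⟨C₀, hC₀, h₀⟩ := exists_norm_deriv_montgomeryP_sub_logDeriv_zeta_le
  obtain ⟨M, hM, hZ⟩ := exists_norm_logDeriv_zeta_add_inv_le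
  refine ⟨C₀ + M, by positivity, fun w h1 h2 h3 ↦ ?_⟩
  calc ‖deriv montgomeryP w + (w - 1)⁻¹‖
      = ‖(deriv montgomeryP w - deriv riemannZeta w / riemannZeta w) +
          (deriv riemannZeta w / riemannZeta w + (w - 1)⁻¹)‖ := by ring_nf
    _ ≤ ‖deriv montgomeryP w - deriv riemannZeta w / riemannZeta w‖ +
          ‖deriv riemannZeta w / riemannZeta w + (w - 1)⁻¹‖ := norm_add_le _ _
    _ ≤ C₀ + M := add_le_add (h₀ w h1) (hZ w h1 h2 h3)

/-! ## Bounds for `P` (integrating `P'` along horizontal segments) -/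

/-- `Σ_p p^{-2}`, the constant comparing `P` with `log ζ`. [folklore] -/
def primeSumTwo : ℝ := ∑' p : Nat.Primes, ((p : ℕ) : ℝ) ^ (-2 : ℝ)

/-- Along a horizontal line, `u ↦ P(u + iy)` has derivative `P'(u+iy)` at every `u > 1`. [folklore] -/
theorem hasDerivAt_montgomeryP_horizontal (y : ℝ) {u : ℝ} (hu : 1 < u) :
    HasDerivAt (fun u : ℝ ↦ montgomeryP ((u : ℂ) + y * I)) (deriv montgomeryP ((u : ℂ) + y * I)) u := by
  have h1 : HasDerivAt (fun z : ℂ ↦ z + y * I) 1 (u : ℂ) := (hasDerivAt_id (u : ℂ)).add_const _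
  have hre : 1 < (((u : ℂ) + y * I)).re := by simpa using hu
  have h2 : HasDerivAt (fun z : ℂ ↦ montgomeryP (z + y * I))
      (deriv montgomeryP ((u : ℂ) + y * I) * 1) (u : ℂ) :=
    (differentiableAt_montgomeryP hre).hasDerivAt.comp (u : ℂ) h1
  rw [mul_one] at h2
  exact h2.comp_ofReal

/-- `‖log(1 + iy)‖ ≤ log 2 + π` for `|y| ≤ 1`. [folklore] -/
theorem norm_log_one_add_mul_I_le {y : ℝ} (hy : |y| ≤ 1) : ‖log (1 + y * I)‖ ≤ Real.log 2 + Real.pi := by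
  have hz1 : 1 ≤ ‖(1 : ℂ) + y * I‖ := by
    calc (1 : ℝ) = |((1 : ℂ) + y * I).re| := by simp
      _ ≤ ‖(1 : ℂ) + y * I‖ := abs_re_le_norm _
  have hz2 : ‖(1 : ℂ) + y * I‖ ≤ 2 := by
    calc ‖(1 : ℂ) + y * I‖ ≤ ‖(1 : ℂ)‖ + ‖(y : ℂ) * I‖ := norm_add_le _ _
      _ = 1 + |y| := by simp
      _ ≤ 2 := by linarith
  rw [← re_add_im (log (1 + y * I)), log_re, log_im]
  calc ‖((Real.log ‖(1 : ℂ) + y * I‖ : ℝ) : ℂ) + (arg (1 + y * I) : ℝ) * I‖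
      ≤ ‖((Real.log ‖(1 : ℂ) + y * I‖ : ℝ) : ℂ)‖ + ‖((arg (1 + y * I) : ℝ) : ℂ) * I‖ := norm_add_le _ _
    _ = |Real.log ‖(1 : ℂ) + y * I‖| + |arg (1 + y * I)| := by simp
    _ ≤ Real.log 2 + Real.pi := by
        refine add_le_add ?_ (abs_arg_le_pi _)
        rw [abs_of_nonneg (Real.log_nonneg hz1)]
        exact Real.log_le_log (by linarith) hz2

/-- **`P(w) + log(w − 1)` is bounded near `w = 1`**: on `1 < Re w ≤ 2`, `|Im w| ≤ 1`,
`‖P(w) + log(w−1)‖ ≤ C` (principal logarithm). This is the behaviour `log ζ(s) = −log(s−1) + O(1)`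
transferred to `P` (prime powers and the pole of `ζ`); cf. `g_k(s) = f₁(s)(s−1−ik)^{b̂(k)}`,
Lemma 4 (18) at `k = 0`. [cite: Montgomery1983, Lemma 4 (18)] -/
theorem exists_norm_montgomeryP_add_log_le :
    ∃ C : ℝ, 0 ≤ C ∧ ∀ w : ℂ, 1 < w.re → w.re ≤ 2 → |w.im| ≤ 1 →
      ‖montgomeryP w + log (w - 1)‖ ≤ C := by
  obtain ⟨C', hC', hD⟩ := exists_norm_deriv_montgomeryP_add_inv_le
  have hS : 0 ≤ primeSumTwo := tsum_nonneg fun p ↦ Real.rpow_nonneg (Nat.cast_nonneg _) _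
  refine ⟨Real.log 2 + primeSumTwo + (Real.log 2 + Real.pi) + C', by positivity, fun w h1 h2 h3 ↦ ?_⟩
  set x := w.re with hx
  set y := w.im with hy
  have hw : w = (x : ℂ) + y * I := (re_add_im w).symm
  -- the function `φ(u) = P(u+iy) + log(u+iy-1)` on `[x, 2]`
  set φ : ℝ → ℂ := fun u ↦ montgomeryP ((u : ℂ) + y * I) + log ((u : ℂ) + y * I - 1) with hφ
  have hderiv : ∀ u ∈ Icc x 2, HasDerivWithinAt φ
      (deriv montgomeryP ((u : ℂ) + y * I) + ((u : ℂ) + y * I - 1)⁻¹) (Icc x 2) u := by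
    intro u hu
    have hu1 : 1 < u := h1.trans_le hu.1
    refine HasDerivAt.hasDerivWithinAt ?_
    refine (hasDerivAt_montgomeryP_horizontal y hu1).add ?_
    have hl : HasDerivAt (fun z : ℂ ↦ log (z + y * I - 1)) (1 / ((u : ℂ) + y * I - 1)) (u : ℂ) := by
      have h0 : HasDerivAt (fun z : ℂ ↦ z + y * I - 1) 1 (u : ℂ) :=
        ((hasDerivAt_id (u : ℂ)).add_const _).sub_const _
      exact h0.clog (Or.inl (by simp; linarith))
    rw [one_div] at hl
    exact hl.comp_ofReal
  have hbound : ∀ u ∈ Ico x 2, ‖deriv montgomeryP ((u : ℂ) + y * I) + ((u : ℂ) + y * I - 1)⁻¹‖ ≤ C' := by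
    intro u hu
    have := hD ((u : ℂ) + y * I) (by simp; linarith [hu.1]) (by simp; linarith [hu.2]) (by simpa using h3)
    simpa [sub_eq_add_neg, add_assoc, add_comm, add_left_comm] using this
  have hmvt := norm_image_sub_le_of_norm_deriv_le_segment' hderiv hbound 2 ⟨h2, le_rfl⟩
  -- values at the two ends
  have hφx : φ x = montgomeryP w + log (w - 1) := by simp only [hφ, ← hw]
  have hφ2 : ‖φ 2‖ ≤ Real.log 2 + primeSumTwo + (Real.log 2 + Real.pi) := by
    simp only [hφ]
    refine (norm_add_le _ _).trans (add_le_add ?_ ?_)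
    · have h2re : 1 < (((2 : ℝ) : ℂ) + y * I).re := by simp
      refine (norm_montgomeryP_le_re h2re).trans ?_
      have : (((2 : ℝ) : ℂ) + y * I).re = 2 := by simp
      rw [this]
      have := montgomeryP_re_le (x := 2) one_lt_two
      norm_num at this
      simpa [primeSumTwo] using this
    · have : ((2 : ℝ) : ℂ) + y * I - 1 = 1 + y * I := by push_cast; ring
      rw [this]
      exact norm_log_one_add_mul_I_le h3
  calc ‖montgomeryP w + log (w - 1)‖ = ‖φ x‖ := by rw [hφx]
    _ ≤ ‖φ 2‖ + ‖φ 2 - φ x‖ := by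
        have := norm_sub_le (φ 2) (φ 2 - φ x); simp only [sub_sub_cancel] at this; exact this
    _ ≤ (Real.log 2 + primeSumTwo + (Real.log 2 + Real.pi)) + C' * (2 - x) := add_le_add hφ2 hmvt
    _ ≤ Real.log 2 + primeSumTwo + (Real.log 2 + Real.pi) + C' := by
        nlinarith [h1, h2, hC']

/-- **`P(w) ≪ log log(|Im w| + 4)`** on `1 < Re w ≤ 2`, `|Im w| ≥ 1/2`: precisely
`‖P(w)‖ ≤ log log(|Im w| + 4) + C`. (The bound `log ζ(s) ≪ log log t` of (17) on the line `σ > 1`: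
at `σ₁ = 1 + 1/log(|t|+4)` trivially `|P| ≤ P(σ₁) ≤ log(σ₁/(σ₁−1)) + O(1)`, and between `σ` and `σ₁` one
integrates `P' ≪ log(|t|+4)` over a length `≤ 1/log(|t|+4)`.) [cite: Montgomery1983, §3 (17)] -/
theorem exists_norm_montgomeryP_le_loglog :
    ∃ C : ℝ, 0 ≤ C ∧ ∀ w : ℂ, 1 < w.re → w.re ≤ 2 → 1 / 2 ≤ |w.im| →
      ‖montgomeryP w‖ ≤ Real.log (Real.log (|w.im| + 4)) + C := by
  obtain ⟨C', hC', hD⟩ := exists_norm_deriv_montgomeryP_le_log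
  have hS : 0 ≤ primeSumTwo := tsum_nonneg fun p ↦ Real.rpow_nonneg (Nat.cast_nonneg _) _
  refine ⟨Real.log 2 + primeSumTwo + C', by positivity, fun w h1 h2 h3 ↦ ?_⟩
  set x := w.re with hx
  set y := w.im with hy
  set L := Real.log (|y| + 4) with hL
  have hL1 : 1 < L := by
    rw [hL, ← Real.log_exp 1]
    refine Real.log_lt_log (Real.exp_pos 1) ?_
    linarith [Real.exp_one_lt_d9, abs_nonneg y]
  have hL0 : 0 < L := by linarith
  set x₁ : ℝ := 1 + 1 / L with hx₁
  have hx₁1 : 1 < x₁ := by rw [hx₁]; have := one_div_pos.2 hL0; linarith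
  have hx₁2 : x₁ < 2 := by
    rw [hx₁]; have : 1 / L < 1 := by rw [div_lt_one hL0]; exact hL1
    linarith
  have hw : w = (x : ℂ) + y * I := (re_add_im w).symm
  -- the trivial bound at and beyond `x₁`
  have htriv : ∀ x' : ℝ, x₁ ≤ x' → x' ≤ 2 →
      ‖montgomeryP ((x' : ℂ) + y * I)‖ ≤ Real.log 2 + Real.log L + primeSumTwo := by
    intro x' hx'1 hx'2
    have hx'0 : 1 < x' := hx₁1.trans_le hx'1
    have hre : 1 < (((x' : ℂ) + y * I)).re := by simpa using hx'0
    refine (norm_montgomeryP_le_re hre).trans ?_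
    have : (((x' : ℂ) + y * I)).re = x' := by simp
    rw [this]
    refine (montgomeryP_re_le hx'0).trans ?_
    have hq : x' / (x' - 1) ≤ 2 * L := by
      have h1' : x' / (x' - 1) = 1 + 1 / (x' - 1) := by
        have hne : x' - 1 ≠ 0 := by linarith
        field_simp; ring
      have h2' : 1 / (x' - 1) ≤ 1 / (x₁ - 1) :=
        one_div_le_one_div_of_le (by linarith) (by linarith)
      have h3' : 1 / (x₁ - 1) = L := by rw [hx₁]; field_simp; ring
      linarith
    have hlog : Real.log (x' / (x' - 1)) ≤ Real.log 2 + Real.log L := by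
      rw [← Real.log_mul (by norm_num) hL0.ne']
      exact Real.log_le_log (div_pos (by linarith) (by linarith)) hq
    unfold primeSumTwo
    linarith
  rcases le_or_gt x₁ x with hxx | hxx
  · -- `x ≥ x₁`
    rw [hw]
    refine (htriv x hxx h2).trans ?_
    linarith
  · -- `1 < x < x₁`: integrate `P'` from `x` to `x₁`
    set ψ : ℝ → ℂ := fun u ↦ montgomeryP ((u : ℂ) + y * I) with hψ
    have hderiv : ∀ u ∈ Icc x x₁, HasDerivWithinAt ψ (deriv montgomeryP ((u : ℂ) + y * I)) (Icc x x₁) u :=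
      fun u hu ↦ (hasDerivAt_montgomeryP_horizontal y (h1.trans_le hu.1)).hasDerivWithinAt
    have hbound : ∀ u ∈ Ico x x₁, ‖deriv montgomeryP ((u : ℂ) + y * I)‖ ≤ C' * L := by
      intro u hu
      have := hD ((u : ℂ) + y * I) (by simp; linarith [hu.1]) (by simp; linarith [hu.2])
        (by simpa using h3)
      simpa [hL] using this
    have hmvt := norm_image_sub_le_of_norm_deriv_le_segment' hderiv hbound x₁ ⟨hxx.le, le_rfl⟩
    have hlen : C' * L * (x₁ - x) ≤ C' := by
      have : x₁ - x ≤ 1 / L := by rw [hx₁]; linarith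
      calc C' * L * (x₁ - x) ≤ C' * L * (1 / L) := mul_le_mul_of_nonneg_left this (by positivity)
        _ = C' := by field_simp
    calc ‖montgomeryP w‖ = ‖ψ x‖ := by simp only [hψ, ← hw]
      _ ≤ ‖ψ x₁‖ + ‖ψ x₁ - ψ x‖ := by
          have := norm_sub_le (ψ x₁) (ψ x₁ - ψ x); simp only [sub_sub_cancel] at this; exact this
      _ ≤ (Real.log 2 + Real.log L + primeSumTwo) + C' * L * (x₁ - x) :=
          add_le_add (htriv x₁ le_rfl hx₁2.le) hmvt
      _ ≤ Real.log L + (Real.log 2 + primeSumTwo + C') := by linarith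

end Literature.Barriers.RiemannHypothesis

end
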